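import Mathlib
import HarnessLib
import Summits.HubbardSuperconductivity.HubbardSuperconductivity.Theorems.KLProgrammeSalmhoferCutoffDerivTableRecordV2

/-!
# Route `KLProgramme` — engine support (cell gate-hubbard-kl, #22a (2e) «sharp χ₂ table», seat p2 g18): the GEVREY SHAPE with realistic
# numerals — `|smoothTransition^{(l)}(x)| ≤ 5·(l!)²·(199/99)ˡ` and `‖Dˡχ₂(x)‖ ≤ 5·(l!)²·(796/297)ˡ` for ALL `l`, ALL `x`

The engine's cutoff-table hypotheses are stated in the Gevrey-2 shape `‖Dˡχ₂‖ ≤ X₀·(l!)²·C_χˡ`; the tree had `(X₀, C_χ) = (8, 342)`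
(`Literature/…/SalmhoferCutoffGevrey`) and `(7, 10)` (`…SalmhoferCutoffDerivTableRecord.salmhoferCutoff_gevrey_table_sharp`).  From the
one-term Cauchy table of `…SmoothTransitionCauchySharp` (`5·l!·(199l/99)ˡ·e^{−l}` for `l ≥ 6`, with `lˡe^{−l} ≤ l!`) and the proved rows
`l ≤ 5` (`1, 2, 11, 1245, 20740, 553800`): **`(X₀, C) = (5, 199/99)` for `σ`** and **`(X₀, C_χ) = (5, 796/297 ≈ 2.68)` for `χ₂`**
(`796/297 = (4/3)·(199/99)`; table form also with the round `27/10`).  Asymptotically this is the true growth class up to a polynomial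
factor (`sup|σ^{(l)}| ≍ (l!)²·2ˡ·l^{−1/2}`).  Pure real analysis; nothing about the model.
References: Salmhofer 1999 §4.2.5 (4.71); Disertori–Rivasseau 2000 §II.2 (Gevrey cutoffs); [cite: BenfattoGiulianiMastropietro2006] §2.2 (2.9).
-/

noncomputable section

namespace Summit.HubbardSuperconductivity.HubbardSuperconductivity.Theorems.KLRegimeSplit

set_option linter.dupNamespace false -- summit = problem name (single-conjunct summit), D-0017

open Literature.MathematicalPhysics.QuantumLattice
open scoped Nat

/-- **Gevrey shape for `smoothTransition` with realistic numerals**: `|σ^{(l)}(x)| ≤ 5·(l!)²·(199/99)ˡ` for every `l`, `x`.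
[cite: BenfattoGiulianiMastropietro2006, §2.2 (2.9)] -/
theorem abs_iteratedDeriv_smoothTransition_le_gevrey_sharp (l : ℕ) (x : ℝ) :
    |iteratedDeriv l Real.smoothTransition x| ≤ 5 * ((l ! : ℝ)) ^ 2 * (199 / 99 : ℝ) ^ l := by
  by_cases h6 : 6 ≤ l
  · refine (abs_iteratedDeriv_smoothTransition_le_cauchy_sharp h6 x).trans ?_
    have hp : ((199 / 99 : ℝ) * l) ^ l * Real.exp (-l) ≤ (199 / 99 : ℝ) ^ l * l ! := by
      rw [mul_pow, mul_assoc]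
      exact mul_le_mul_of_nonneg_left (pow_self_mul_exp_neg_le_factorial l) (by positivity)
    calc 5 * (l ! : ℝ) * ((199 / 99 : ℝ) * l) ^ l * Real.exp (-l) = 5 * (l ! : ℝ) * (((199 / 99 : ℝ) * l) ^ l * Real.exp (-l)) := by ring
      _ ≤ 5 * (l ! : ℝ) * ((199 / 99 : ℝ) ^ l * l !) := by gcongr
      _ = 5 * ((l ! : ℝ)) ^ 2 * (199 / 99 : ℝ) ^ l := by ring
  · rw [not_le] at h6
    have h := abs_iteratedDeriv_smoothTransition_le_cauchyTab l x
    interval_cases l <;> simp only [smoothTransitionCauchyTab] at h <;> norm_num [Nat.factorial] at h ⊢ <;>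
      first
        | linarith
        | linarith [abs_iteratedDeriv_three_smoothTransition_le x]
        | linarith [abs_iteratedDeriv_four_smoothTransition_le x]
        | linarith [abs_iteratedDeriv_five_smoothTransition_le x]

/-- **Gevrey shape for `χ₂` with realistic numerals**: `‖iteratedFDeriv ℝ l χ₂ x‖ ≤ 5·(l!)²·(796/297)ˡ` for every `l`, `x`
(`796/297 = (4/3)·(199/99) ≈ 2.680`). [cite: BenfattoGiulianiMastropietro2006, §2.2 (2.9)] -/
theorem norm_iteratedFDeriv_salmhoferCutoff_le_gevrey_sharp2 (l : ℕ) (x : ℝ) :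
    ‖iteratedFDeriv ℝ l salmhoferCutoff x‖ ≤ 5 * ((l ! : ℝ)) ^ 2 * (796 / 297 : ℝ) ^ l := by
  rw [norm_iteratedFDeriv_eq_norm_iteratedDeriv, Real.norm_eq_abs, iteratedDeriv_salmhoferCutoff, abs_mul, abs_pow,
    abs_of_pos (by norm_num : (0 : ℝ) < 4 / 3)]
  calc (4 / 3 : ℝ) ^ l * |iteratedDeriv l Real.smoothTransition (4 / 3 * x - 1 / 3)|
      ≤ (4 / 3 : ℝ) ^ l * (5 * ((l ! : ℝ)) ^ 2 * (199 / 99 : ℝ) ^ l) :=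
        mul_le_mul_of_nonneg_left (abs_iteratedDeriv_smoothTransition_le_gevrey_sharp l _) (by positivity)
    _ = 5 * ((l ! : ℝ)) ^ 2 * ((4 / 3 : ℝ) * (199 / 99)) ^ l := by rw [mul_pow]; ring
    _ = 5 * ((l ! : ℝ)) ^ 2 * (796 / 297 : ℝ) ^ l := by norm_num

/-- The table form with the round base `27/10`: `∀ l ≤ N, ∀ x, ‖Dˡχ₂(x)‖ ≤ 5·(l!)²·(27/10)ˡ` — a drop-in for `salmhoferCutoff_gevrey_table`
with `(X₀, C_χ) = (5, 27/10)` in place of `(8, 342)`. [cite: BenfattoGiulianiMastropietro2006, §2.2 (2.9)] -/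
theorem salmhoferCutoff_gevrey_table_sharp2 (N : ℕ) :
    ∀ l ≤ N, ∀ x : ℝ, ‖iteratedFDeriv ℝ l salmhoferCutoff x‖ ≤ 5 * ((l ! : ℝ)) ^ 2 * (27 / 10 : ℝ) ^ l := by
  intro l _ x
  refine (norm_iteratedFDeriv_salmhoferCutoff_le_gevrey_sharp2 l x).trans ?_
  exact mul_le_mul_of_nonneg_left (pow_le_pow_left₀ (by norm_num) (by norm_num) l) (by positivity)

/-- The same for `smoothTransition` with the round base `101/50`: `|σ^{(l)}(x)| ≤ 5·(l!)²·(101/50)ˡ` (`199/99 < 2.02`). [cite: BenfattoGiulianiMastropietro2006, §2.2 (2.9)] -/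
theorem abs_iteratedDeriv_smoothTransition_le_gevrey_sharp' (l : ℕ) (x : ℝ) :
    |iteratedDeriv l Real.smoothTransition x| ≤ 5 * ((l ! : ℝ)) ^ 2 * (101 / 50 : ℝ) ^ l := by
  refine (abs_iteratedDeriv_smoothTransition_le_gevrey_sharp l x).trans ?_
  exact mul_le_mul_of_nonneg_left (pow_le_pow_left₀ (by norm_num) (by norm_num) l) (by positivity)

end Summit.HubbardSuperconductivity.HubbardSuperconductivity.Theorems.KLRegimeSplit

end
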